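/-
Copyright (c) 2026 the pub-hodgecm-mathlib formalisation cell (harness21).  Prover seat hodgecm-mathlib-K2Liu-p08 (g0), Track B «K2-LIT»,
#184♮ = hLiu418 = `stmt-HodgeConjecture-24832`; LEAD F0P6-plan (g12) M-156e (O2) + 06:33:19Z «NEXT: G1 file 2»; SIGS-RoadI-v3 §G1 (G1.3).
Road I v3, organ G1, file 2 (the residue form); inputs ★ G1 file 1 `K2LiuContinuationLieDerivative`, ★ U0, ★ `K2LiuFirstTermResidueChain` §1.
-/
import Summits.HodgeConjecture.HodgeConjecture.Theorems.K2LiuContinuationLieDerivative   -- ★ G1 file 1: `hasDerivAt_continuation_orbit`, `exists_bound_orbit`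
import Summits.HodgeConjecture.HodgeConjecture.Theorems.K2LiuFirstTermResidueChain        -- ★ `exists_tendsto_sub_div_prod_sub` ((s − s₀)/∏(s − p) has a limit)
import Mathlib.MeasureTheory.Integral.DominatedConvergence
import HarnessLib

/-!
# Crux `HLiu418`, Road I v3, organ G1 file 2: THE `t`-DERIVATIVE OF THE NORMALISED RESIDUE FORM ALONG AN ORBIT
# `∂_t resNorm P E⋆ (γ t) = resNorm P′ E′ (γ t)` (𝔤_∞-equivariance of the residue; SIGS §G1.3)

Cell `hodgecm-mathlib`, crux item hLiu418 = `stmt-HodgeConjecture-24832`; LEAD F0P6-plan (g12), co-dealer K2E5-plan (g5), boxes K2E5-r01 (g6) ∕ K2Liu-ref1 (g2).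
THEOREMS ONLY (no `def`, no instance, no notation, no named-fact hypothesis, no `sorry`); lane `--supports stmt-HodgeConjecture-24832 --as helper`
(count-neutral).  Consumers: Hol (holomorphic type of the residue: `𝔭⁻`-annihilation), U5; in `resGen` currency via ★ `resGen_eq_resNorm_of_continuation`.

THE MATHEMATICS.  Data BY VALUE exactly as in ★ G1 file 1 `hasDerivAt_continuation_orbit`: `(P, E⋆)` with socket #41's clause (i) for `f`, `(P′, E′)` with
(i), (ii), (v) for the derived family `f′`, a continuous orbit `γ : ℝ → H(𝔸)` with two-sided height bounds on segments, and the TERM-WISE identity (G1.1) on a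
half-plane.  File 1 gives, for every `s ∈ {0 < re}`, `∂_t [E⋆(s, γ t)·∏_{P′}(s − p)] = E′(s, γ t)·∏_P(s − p)`; integrate in `t`, divide by the two clearing
polynomials and multiply by `(s − ½)` on a punctured neighbourhood of `½` (no roots there):
`(s − ½)E⋆(s, γ t)/∏_P − (s − ½)E⋆(s, γ 0)/∏_P = ∫₀ᵗ (s − ½)E′(s, γ τ)/∏_{P′} dτ`.  Let `s → ½` along `𝓝[≠] ½`: the left side tends to
`resNorm P E⋆ (γ t) − resNorm P E⋆ (γ 0)` (★ U0.1), the right side to `∫₀ᵗ resNorm P′ E′ (γ τ) dτ` by DOMINATED CONVERGENCE (integrand → pointwise by ★ U0.1;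
dominated by `sup |(s − ½)/∏_{P′}(s − p)| · C` — the scalar has a limit at `½` (★ `exists_tendsto_sub_div_prod_sub`), `C` from (v) along the segment (★
`exists_bound_orbit`)).  Hence `resNorm P E⋆ (γ t) = resNorm P E⋆ (γ 0) + ∫₀ᵗ resNorm P′ E′ (γ τ) dτ` with a CONTINUOUS integrand (★ U0.3), and FTC-2 gives
**`hasDerivAt_resNorm_orbit`**.  The sheet's remark «the `(s − ½)`-correction term has residue `lim (s − ½)²·(simple pole) = 0`» needs no separate treatment:
it is inside `resNorm P′ E′` through ★ U0.4 (`resNorm_smul` with the factor `(s − ½)` vanishing at `½`, stated here as `resNorm_halfShift_smul_eq_zero`).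
[MoeglinWaldspurger1995, IV.1.9–IV.1.11] [KudlaRallis1994, §1 Thm. 1.1] [Liu2021, Lem. B.12 pp. 103–104] [BorelJacquet1979, §4.1].
HONEST LABEL.  Count-neutral helper; G1 closes no socket by itself; `HC_CM` is proved only modulo the 7 printed citations (2 remaining named inputs:
hLiu418 = `stmt-HodgeConjecture-24832`, h413 = `stmt-HodgeConjecture-24833`) until rung 0 closes.
-/

set_option autoImplicit false
set_option linter.dupNamespace false -- the mandated namespace repeats `HodgeConjecture.HodgeConjecture`
set_option Elab.async false

noncomputable section

open NumberField IsDedekindDomain Filter MeasureTheory Metric Set Complex intervalIntegral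
open scoped Topology BigOperators Interval

namespace Summit.HodgeConjecture.HodgeConjecture.Cruxes.HLiu418.K2LiuResidueLieDerivative

open Literature.NumberTheory.Automorphic
open Literature.NumberTheory.GaloisRepresentations
open Literature.NumberTheory.GelbartRogawski1991 Literature.NumberTheory.GelbartRogawski1991.GRConstruction
open Literature.NumberTheory.K2Lit.SiegelDoubled
open Summit.HodgeConjecture.HodgeConjecture.Cruxes.HLiu418.K2LiuFirstTermResidueFormDefs
open Summit.HodgeConjecture.HodgeConjecture.Cruxes.HLiu418.K2LiuFirstTermResidueForm
open Summit.HodgeConjecture.HodgeConjecture.Cruxes.HLiu418.K2LiuContinuationLieDerivative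
open Summit.HodgeConjecture.HodgeConjecture.Cruxes.HLiu418.K2LiuEisensteinResidueOfGenerators (prod_sub_ne_zero)
open Summit.HodgeConjecture.HodgeConjecture.Cruxes.HLiu418.K2LiuFirstTermResidueChain (exists_tendsto_sub_div_prod_sub)

/-! ## §1 Two pieces of bookkeeping near `½` -/

/-- the regularising scalar `(s − ½)/∏_{p∈Q}(s − p)` is BOUNDED on a punctured neighbourhood of `½` (it has a limit there, ★ `exists_tendsto_sub_div_prod_sub`).
[folklore] -/
theorem eventually_norm_sub_half_div_prod_le (Q : Finset ℂ) :
    ∃ K : ℝ, ∀ᶠ s in 𝓝[≠] (1 / 2 : ℂ), ‖(s - 1 / 2) / ∏ p ∈ Q, (s - p)‖ ≤ K := by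
  obtain ⟨c, hc⟩ := exists_tendsto_sub_div_prod_sub Q (1 / 2)
  refine ⟨‖c‖ + 1, ?_⟩
  have h := hc.norm
  exact (h.eventually (gt_mem_nhds (lt_add_one ‖c‖))).mono fun s hs => hs.le

/-- a punctured neighbourhood of `½` inside `{0 < re}` and off the finite set `P ∪ P′`. [folklore] -/
theorem eventually_re_pos_notMem (P P' : Finset ℂ) :
    ∀ᶠ s in 𝓝[≠] (1 / 2 : ℂ), 0 < s.re ∧ s ∉ P ∧ s ∉ P' := by
  have hBfin : ((((↑P : Set ℂ) ∪ (↑P' : Set ℂ))) \ {(1 / 2 : ℂ)}).Finite := (P.finite_toSet.union P'.finite_toSet).sdiff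
  have hopen : IsOpen ({w : ℂ | 0 < w.re} \ ((((↑P : Set ℂ) ∪ (↑P' : Set ℂ))) \ {(1 / 2 : ℂ)})) :=
    (isOpen_lt continuous_const Complex.continuous_re).sdiff hBfin.isClosed
  have hmem : (1 / 2 : ℂ) ∈ {w : ℂ | 0 < w.re} \ ((((↑P : Set ℂ) ∪ (↑P' : Set ℂ))) \ {(1 / 2 : ℂ)}) := ⟨re_half_pos, fun h' => h'.2 rfl⟩
  filter_upwards [mem_nhdsWithin_of_mem_nhds (hopen.mem_nhds hmem), self_mem_nhdsWithin] with s hs hne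
  exact ⟨hs.1, fun hp => hs.2 ⟨Or.inl hp, hne⟩, fun hp => hs.2 ⟨Or.inr hp, hne⟩⟩

/-! ## §2 The derivative of the residue form along an orbit -/

section Frame

variable (L : Type) [Field L] [NumberField L] [IsCMField L]
variable {N M n : ℕ} (e : Fin N × Fin M ≃ Fin n)
  (dV : Fin N → L) (hdV : ∀ i, IsCMField.complexConj L (dV i) = dV i)
  (dW : Fin M → L) (hdW : ∀ i, IsCMField.complexConj L (dW i) = dW i)

/-- **THE INTEGRATED RESIDUE IDENTITY** `resNorm P E⋆ (γ t) − resNorm P E⋆ (γ 0) = ∫₀ᵗ resNorm P′ E′ (γ τ) dτ` (hypotheses as in ★ G1 file 1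
`hasDerivAt_continuation_orbit`; dominated convergence along `𝓝[≠] ½`). [cite: MoeglinWaldspurger1995, IV.1.9–IV.1.11] [cite: KudlaRallis1994, §1 Thm. 1.1] -/
theorem resNorm_orbit_sub_eq_integral
    (P : Finset ℂ) (Es : ℂ → HA L e dV hdV dW hdW → ℂ)
    (hd : ∀ h : HA L e dV hdV dW hdW, DifferentiableOn ℂ (fun s => Es s h) {s : ℂ | 0 < s.re})
    (P' : Finset ℂ) (E' : ℂ → HA L e dV hdV dW hdW → ℂ)
    (hd' : ∀ h : HA L e dV hdV dW hdW, DifferentiableOn ℂ (fun s => E' s h) {s : ℂ | 0 < s.re})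
    (hii' : ∀ s : ℂ, 0 < s.re → Continuous (E' s))
    (hv' : ∀ z : ℂ, 0 < z.re → ∃ C A r : ℝ, 0 < r ∧ ∀ s : ℂ, dist s z < r → ∀ h : HA L e dV hdV dW hdW,
      ‖E' s h‖ ≤ C * adelicHeightGL (n + n) L (h : GL (Fin (n + n)) (AdeleRing (𝓞 L) L)) ^ A)
    (γ : ℝ → HA L e dV hdV dW hdW) (hγc : Continuous γ)
    (hγ : ∀ R : ℝ, ∃ B₁ B₂ : ℝ, 0 < B₁ ∧ ∀ t : ℝ, |t| ≤ R →
      B₁ ≤ adelicHeightGL (n + n) L ((γ t : HA L e dV hdV dW hdW) : GL (Fin (n + n)) (AdeleRing (𝓞 L) L)) ∧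
        adelicHeightGL (n + n) L ((γ t : HA L e dV hdV dW hdW) : GL (Fin (n + n)) (AdeleRing (𝓞 L) L)) ≤ B₂)
    {s₁ : ℝ} (hs₁ : 0 ≤ s₁)
    (hterm : ∀ s : ℂ, s₁ < s.re → ∀ t : ℝ,
      HasDerivAt (fun t => Es s (γ t) / ∏ p ∈ P, (s - p)) (E' s (γ t) / ∏ p ∈ P', (s - p)) t)
    (t : ℝ) :
    resNorm P Es (γ t) - resNorm P Es (γ 0) = ∫ τ in (0 : ℝ)..t, resNorm P' E' (γ τ) := by
  -- (1) the integrated, polynomial-cleared identity at every `s ∈ {0 < re}`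
  have hI : ∀ s : ℂ, 0 < s.re → Es s (γ t) * ∏ p ∈ P', (s - p) - Es s (γ 0) * ∏ p ∈ P', (s - p) =
      ∫ τ in (0 : ℝ)..t, E' s (γ τ) * ∏ p ∈ P, (s - p) := by
    intro s hs
    exact (intervalIntegral.integral_eq_sub_of_hasDerivAt
      (fun τ _ => hasDerivAt_continuation_orbit L e dV hdV dW hdW P Es hd P' E' hd' hii' hv' γ hγc hγ hs₁ hterm s hs τ)
      ((((hii' s hs).comp hγc).mul continuous_const).intervalIntegrable _ _)).symm
  -- (2) the `(s − ½)`-normalised identity on a punctured neighbourhood of `½`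
  have hev : ∀ᶠ s in 𝓝[≠] (1 / 2 : ℂ),
      (∫ τ in (0 : ℝ)..t, (s - 1 / 2) * (E' s (γ τ) / ∏ p ∈ P', (s - p))) =
        (s - 1 / 2) * (Es s (γ t) / ∏ p ∈ P, (s - p)) - (s - 1 / 2) * (Es s (γ 0) / ∏ p ∈ P, (s - p)) := by
    filter_upwards [eventually_re_pos_notMem P P'] with s hs
    obtain ⟨hs0, hsP, hsP'⟩ := hs
    have hQ : ∏ p ∈ P, (s - p) ≠ 0 := prod_sub_ne_zero P hsP
    have hQ' : ∏ p ∈ P', (s - p) ≠ 0 := prod_sub_ne_zero P' hsP'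
    have h1 := hI s hs0
    -- multiply (1) by `k := (s − ½)/(∏_P · ∏_{P′})`
    have h2 : (s - 1 / 2) / ((∏ p ∈ P, (s - p)) * ∏ p ∈ P', (s - p)) *
        (Es s (γ t) * ∏ p ∈ P', (s - p) - Es s (γ 0) * ∏ p ∈ P', (s - p)) =
        (s - 1 / 2) / ((∏ p ∈ P, (s - p)) * ∏ p ∈ P', (s - p)) * ∫ τ in (0 : ℝ)..t, E' s (γ τ) * ∏ p ∈ P, (s - p) := by
      rw [h1]
    rw [← intervalIntegral.integral_const_mul, mul_sub] at h2
    have hA : ∀ a : ℂ, (s - 1 / 2) / ((∏ p ∈ P, (s - p)) * ∏ p ∈ P', (s - p)) * (a * ∏ p ∈ P', (s - p)) =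
        (s - 1 / 2) * (a / ∏ p ∈ P, (s - p)) := fun a => by
      field_simp
    have hB : ∀ b : ℂ, (s - 1 / 2) / ((∏ p ∈ P, (s - p)) * ∏ p ∈ P', (s - p)) * (b * ∏ p ∈ P, (s - p)) =
        (s - 1 / 2) * (b / ∏ p ∈ P', (s - p)) := fun b => by
      field_simp
    simp only [hA, hB] at h2
    exact h2.symm
  -- (3) limits of the three terms along `𝓝[≠] ½`
  have hL : Tendsto (fun s : ℂ => (s - 1 / 2) * (Es s (γ t) / ∏ p ∈ P, (s - p)) - (s - 1 / 2) * (Es s (γ 0) / ∏ p ∈ P, (s - p)))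
      (𝓝[≠] (1 / 2)) (𝓝 (resNorm P Es (γ t) - resNorm P Es (γ 0))) :=
    (tendsto_resNorm P Es hd (γ t)).sub (tendsto_resNorm P Es hd (γ 0))
  -- dominated convergence for the right-hand side
  obtain ⟨K, hK⟩ := eventually_norm_sub_half_div_prod_le P'
  obtain ⟨C, r, hr, hC⟩ := exists_bound_orbit L e dV hdV dW hdW E' hv' γ hγ (1 / 2) re_half_pos |t|
  have hτR : ∀ τ ∈ Ι (0 : ℝ) t, |τ| ≤ |t| := by
    intro τ hτ
    rw [Set.mem_uIoc] at hτ
    rcases hτ with ⟨h1, h2⟩ | ⟨h1, h2⟩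
    · rw [abs_of_pos h1]; exact h2.trans (le_abs_self t)
    · rw [abs_of_nonpos h2]; exact (neg_le_neg h1.le).trans (neg_le_abs t)
  have hR : Tendsto (fun s : ℂ => ∫ τ in (0 : ℝ)..t, (s - 1 / 2) * (E' s (γ τ) / ∏ p ∈ P', (s - p))) (𝓝[≠] (1 / 2))
      (𝓝 (∫ τ in (0 : ℝ)..t, resNorm P' E' (γ τ))) := by
    refine intervalIntegral.tendsto_integral_filter_of_dominated_convergence (fun _ => K * C) ?_ ?_ intervalIntegrable_const ?_
    · filter_upwards [eventually_re_pos_notMem P P'] with s hs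
      exact (continuous_const.mul ((((hii' s hs.1).comp hγc).div_const _))).aestronglyMeasurable
    · filter_upwards [hK, inter_mem_nhdsWithin _ (ball_mem_nhds (1 / 2 : ℂ) hr)] with s hsK hsr
      refine Eventually.of_forall fun τ hτ => ?_
      have hsr' : dist s (1 / 2) < r := hsr.2
      rw [show (s - 1 / 2) * (E' s (γ τ) / ∏ p ∈ P', (s - p)) = (s - 1 / 2) / (∏ p ∈ P', (s - p)) * E' s (γ τ) by ring,
        norm_mul]
      exact mul_le_mul hsK (hC s hsr' τ (hτR τ hτ)) (norm_nonneg _) ((norm_nonneg _).trans hsK)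
    · exact Eventually.of_forall fun τ _ => tendsto_resNorm P' E' hd' (γ τ)
  -- (4) uniqueness of the limit
  exact tendsto_nhds_unique hL (hR.congr' hev)

/-- **G1.3 — THE `t`-DERIVATIVE OF THE NORMALISED RESIDUE FORM ALONG AN ORBIT**: under the hypotheses of ★ G1 file 1 `hasDerivAt_continuation_orbit`,
`HasDerivAt (fun t => resNorm P E⋆ (γ t)) (resNorm P′ E′ (γ t)) t` for every `t` (the integrated residue identity + continuity of `resNorm P′ E′ ∘ γ` (★ U0.3) +
FTC-2).  In `resGen` currency: combine with ★ `resGen_eq_resNorm_of_continuation`. [cite: MoeglinWaldspurger1995, IV.1.9–IV.1.11] [cite: KudlaRallis1994, §1 Thm. 1.1]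
[cite: Liu2021, Lem. B.12 pp. 103–104] -/
theorem hasDerivAt_resNorm_orbit
    (P : Finset ℂ) (Es : ℂ → HA L e dV hdV dW hdW → ℂ)
    (hd : ∀ h : HA L e dV hdV dW hdW, DifferentiableOn ℂ (fun s => Es s h) {s : ℂ | 0 < s.re})
    (P' : Finset ℂ) (E' : ℂ → HA L e dV hdV dW hdW → ℂ)
    (hd' : ∀ h : HA L e dV hdV dW hdW, DifferentiableOn ℂ (fun s => E' s h) {s : ℂ | 0 < s.re})
    (hii' : ∀ s : ℂ, 0 < s.re → Continuous (E' s))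
    (hv' : ∀ z : ℂ, 0 < z.re → ∃ C A r : ℝ, 0 < r ∧ ∀ s : ℂ, dist s z < r → ∀ h : HA L e dV hdV dW hdW,
      ‖E' s h‖ ≤ C * adelicHeightGL (n + n) L (h : GL (Fin (n + n)) (AdeleRing (𝓞 L) L)) ^ A)
    (γ : ℝ → HA L e dV hdV dW hdW) (hγc : Continuous γ)
    (hγ : ∀ R : ℝ, ∃ B₁ B₂ : ℝ, 0 < B₁ ∧ ∀ t : ℝ, |t| ≤ R →
      B₁ ≤ adelicHeightGL (n + n) L ((γ t : HA L e dV hdV dW hdW) : GL (Fin (n + n)) (AdeleRing (𝓞 L) L)) ∧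
        adelicHeightGL (n + n) L ((γ t : HA L e dV hdV dW hdW) : GL (Fin (n + n)) (AdeleRing (𝓞 L) L)) ≤ B₂)
    {s₁ : ℝ} (hs₁ : 0 ≤ s₁)
    (hterm : ∀ s : ℂ, s₁ < s.re → ∀ t : ℝ,
      HasDerivAt (fun t => Es s (γ t) / ∏ p ∈ P, (s - p)) (E' s (γ t) / ∏ p ∈ P', (s - p)) t)
    (t : ℝ) :
    HasDerivAt (fun t => resNorm P Es (γ t)) (resNorm P' E' (γ t)) t := by
  have hcont : Continuous fun τ => resNorm P' E' (γ τ) := (continuous_resNorm L e dV hdV dW hdW P' E' hii').comp hγc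
  have heq : (fun t => resNorm P Es (γ t)) = fun t => resNorm P Es (γ 0) + ∫ τ in (0 : ℝ)..t, resNorm P' E' (γ τ) := by
    funext t'
    rw [← resNorm_orbit_sub_eq_integral L e dV hdV dW hdW P Es hd P' E' hd' hii' hv' γ hγc hγ hs₁ hterm t', add_sub_cancel]
  rw [heq]
  exact (intervalIntegral.integral_hasDerivAt_right (hcont.intervalIntegrable _ _) (hcont.stronglyMeasurableAtFilter _ _)
    hcont.continuousAt).const_add _

end Frame

end Summit.HodgeConjecture.HodgeConjecture.Cruxes.HLiu418.K2LiuResidueLieDerivative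

end
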